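import Summits.Ventures.DiscreteObjects.Hadamard.CycleParityProjector
import Summits.Ventures.DiscreteObjects.Hadamard.ConferenceGraph333OddFixedPoints

/-!
# Automorphism groups of srg(333,166,82,83) of order prime to 37 have an ODD number of orbits (kernel)

Framing: lottery ticket; floor = certified bounds/negative ranges.  Cell pub-namedobj (venture DiscreteObjects),
target (H) = `H(668)`, hadamard gen 29.  The group version of the cycle-type parity law (`CycleParityProjector`,
`ConferenceGraph333CycleParity`: for one automorphism the number of orbits — cycles, fixed points included — is odd):
for a GROUP `G` of adjacency-preserving permutations with `37 ∤ |G|`, every element has order prime to `37`, so all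
twisted traces `Σ_x S_{x,gx}` vanish (`ConferenceGraph333OddFixedPoints.aut_twisted_trace_zero`); with the group
average `Q = |G|⁻¹ Σ_g P_g` (the projector onto the `G`-invariants) and the eigenprojector `π₊ = (S² + √333 S)/666` the
idempotent `Q π₊` has trace `rank ∈ ℕ` equal to `(2|G|)⁻¹ Σ_g (#Fix g − 1) = (#orbits − 1)/2` (Burnside), hence:
* **`autGroup_card_orbits_odd`** — the number of `G`-orbits on the `333` vertices is ODD (so, with gen 28's
  `ConferenceGraph333TwoCells`, it is `1` or `≥ 3`; and `1` is impossible here since transitivity needs `37 ∣ |G|`: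
  **`autGroup_three_le_card_orbits`** — at least three orbits).
Representation-theoretically: the `√333`-eigenspace is a `G`-module and the non-trivial part of the permutation module is
twice it, so every `G`-invariant count inherits a parity.  Structure of a HYPOTHETICAL object; ours (PROVISIONAL).
No `sorry`, no new definitions.
-/

namespace Summit.Ventures.DiscreteObjects.Hadamard

open Finset MulAction

section grouporbits
variable {V : Type*} [Fintype V] [DecidableEq V]

/-- **Odd number of orbits.**  For a group `G` of automorphisms of an `srg(333,166,82,83)` with `37 ∤ |G|`, the number of
`G`-orbits on the vertex set is odd. -/
theorem autGroup_card_orbits_odd (hV : Fintype.card V = 333) (A : Matrix V V ℤ)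
    (h01 : ∀ x y, A x y = 0 ∨ A x y = 1) (hsymm : ∀ x y, A y x = A x y) (hdiag : ∀ x, A x x = 0)
    (hk : ∀ x, ∑ y, A x y = 166) (hsrg : ∀ x y, ∑ z, A x z * A z y = 83 * (1 + (if x = y then 1 else 0)) - A x y)
    (G : Subgroup (Equiv.Perm V)) (hG : ∀ g ∈ G, ∀ x y, A (g x) (g y) = A x y) (h37 : ¬ 37 ∣ Nat.card G) :
    Odd (Nat.card (orbitRel.Quotient G V)) := by
  classical
  letI : Fintype G := Fintype.ofFinite G
  obtain ⟨-, -, hSs, hS1, hSS⟩ := seidel_identities_of_conferenceGraph A h01 hsymm hdiag 83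
    (by rw [hV]; norm_num) (fun x => by rw [hk x]; norm_num) hsrg
  set S : V → V → ℤ := fun x y => 1 - (if x = y then 1 else 0) - 2 * A x y with hS_def
  have hSS' : ∀ x y, ∑ z, S x z * S z y = 333 * (if x = y then 1 else 0) - 1 := fun x y => by
    rw [hSS x y, hV]; norm_num
  have hSs' : ∀ x y, S y x = S x y := fun x y => hSs x y
  have hScol : ∀ y, ∑ x, S x y = 0 := fun y => by
    rw [Finset.sum_congr rfl fun x _ => hSs' y x]; exact hS1 y
  -- twisted traces vanish for every g ∈ G
  have hn : Nat.card G = Fintype.card G := Nat.card_eq_fintype_card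
  have htw : ∀ g : G, ∑ x, S x ((g : Equiv.Perm V) x) = 0 := by
    intro g
    have hpow : (g : Equiv.Perm V) ^ Nat.card G = 1 := by
      rw [← Subgroup.coe_pow, pow_card_eq_one', Subgroup.coe_one]
    have := aut_twisted_trace_zero hV A h01 hsymm hdiag hk hsrg (g : Equiv.Perm V) hpow h37 (hG g g.2)
    simpa [hS_def] using this
  -- complex matrices
  set Sc : Matrix V V ℂ := Matrix.of fun x y => ((S x y : ℤ) : ℂ) with hSc_def
  set Pm : G → Matrix V V ℂ := fun g => Matrix.of fun x y => if (g : Equiv.Perm V) x = y then (1 : ℂ) else 0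
    with hPm_def
  set Jc : Matrix V V ℂ := Matrix.of fun (_ : V) (_ : V) => (1 : ℂ) with hJc_def
  have hPmul : ∀ (g : G) (X : Matrix V V ℂ) x y, (Pm g * X) x y = X ((g : Equiv.Perm V) x) y := by
    intro g X x y
    rw [Matrix.mul_apply]
    simp only [hPm_def, Matrix.of_apply, ite_mul, one_mul, zero_mul]
    rw [Finset.sum_ite_eq]; simp
  have hmulP : ∀ (g : G) (X : Matrix V V ℂ) x y, (X * Pm g) x y = X x ((g : Equiv.Perm V).symm y) := by
    intro g X x y
    rw [Matrix.mul_apply]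
    simp only [hPm_def, Matrix.of_apply, mul_ite, mul_one, mul_zero]
    have e : ∀ z, ((g : Equiv.Perm V) z = y) ↔ (z = (g : Equiv.Perm V).symm y) := fun z =>
      Equiv.apply_eq_iff_eq_symm_apply _
    simp_rw [e]
    rw [Finset.sum_ite_eq']; simp
  have hPP : ∀ g h : G, Pm g * Pm h = Pm (h * g) := by
    intro g h
    ext x y
    rw [hPmul]
    simp only [hPm_def, Matrix.of_apply, Subgroup.coe_mul, Equiv.Perm.mul_apply]
    exact if_congr Iff.rfl rfl rfl
  have hPS : ∀ g : G, Pm g * Sc = Sc * Pm g := by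
    intro g
    ext x y
    rw [hPmul, hmulP]
    simp only [hSc_def, Matrix.of_apply]
    have := hG g g.2 x ((g : Equiv.Perm V).symm y)
    rw [Equiv.apply_symm_apply] at this
    have e2 : ((g : Equiv.Perm V) x = y) ↔ (x = (g : Equiv.Perm V).symm y) := Equiv.apply_eq_iff_eq_symm_apply _
    simp only [hS_def, this, e2]
  have hPJ : ∀ g : G, Pm g * Jc = Jc := by
    intro g; ext x y; rw [hPmul]; simp only [hJc_def, Matrix.of_apply]
  have htrP : ∀ g : G, (Pm g).trace = ((univ.filter fun x => (g : Equiv.Perm V) x = x).card : ℂ) := by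
    intro g
    simp only [Matrix.trace, Matrix.diag, hPm_def, Matrix.of_apply]
    rw [Finset.sum_boole]
  have htrJ : Jc.trace = (333 : ℂ) := by
    simp [Matrix.trace, Matrix.diag, hJc_def, hV]
  have hSS2 : Sc * Sc = (333 : ℂ) • (1 : Matrix V V ℂ) - Jc := by
    ext x y
    rw [Matrix.mul_apply, Matrix.sub_apply, Matrix.smul_apply, Matrix.one_apply]
    simp only [hSc_def, hJc_def, Matrix.of_apply, smul_eq_mul, mul_ite, mul_one, mul_zero]
    have h' : ((∑ z, S x z * S z y : ℤ) : ℂ) = ((333 * (if x = y then 1 else 0) - 1 : ℤ) : ℂ) := by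
      rw [hSS' x y]
    push_cast at h'
    rw [h']
    split_ifs <;> simp
  have hJS : Jc * Sc = 0 := by
    ext x y
    rw [Matrix.mul_apply]
    simp only [hSc_def, hJc_def, Matrix.of_apply, one_mul, Matrix.zero_apply]
    exact_mod_cast hScol y
  have hS3 : Sc * Sc * Sc = (333 : ℂ) • Sc := by
    rw [hSS2, Matrix.sub_mul, Matrix.smul_mul, Matrix.one_mul, hJS, sub_zero]
  have htrPS : ∀ g : G, (Pm g * Sc).trace = 0 := by
    intro g
    simp only [Matrix.trace, Matrix.diag]
    rw [Finset.sum_congr rfl fun x _ => hPmul g Sc x x]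
    simp only [hSc_def, Matrix.of_apply]
    rw [Finset.sum_congr rfl fun x _ => by rw [hSs' x ((g : Equiv.Perm V) x)]]
    exact_mod_cast htw g
  have htrPS2 : ∀ g : G, (Pm g * (Sc * Sc)).trace =
      (333 : ℂ) * ((univ.filter fun x => (g : Equiv.Perm V) x = x).card : ℂ) - 333 := by
    intro g
    rw [hSS2, Matrix.mul_sub, Matrix.mul_smul, Matrix.mul_one, hPJ, Matrix.trace_sub, Matrix.trace_smul, htrP,
      htrJ, smul_eq_mul]
  -- the eigenprojector π₊
  set c : ℂ := ((Real.sqrt 333 : ℝ) : ℂ) with hc_def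
  have hcc : c * c = (333 : ℂ) := by
    rw [hc_def, ← Complex.ofReal_mul, Real.mul_self_sqrt (by norm_num)]
    simp
  have h2v : (2 * (333 : ℂ)) ≠ 0 := by norm_num
  set πp : Matrix V V ℂ := (2 * (333 : ℂ))⁻¹ • (Sc * Sc + c • Sc) with hπ_def
  have hY : (Sc * Sc + c • Sc) * (Sc * Sc + c • Sc) = (2 * (333 : ℂ)) • (Sc * Sc + c • Sc) := by
    have e1 : Sc * Sc * (Sc * Sc) = (333 : ℂ) • (Sc * Sc) := by rw [← Matrix.mul_assoc, hS3, Matrix.smul_mul]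
    have e2 : Sc * (Sc * Sc) = (333 : ℂ) • Sc := by rw [← Matrix.mul_assoc, hS3]
    rw [Matrix.add_mul, Matrix.mul_add, Matrix.mul_add, Matrix.smul_mul, Matrix.mul_smul, Matrix.smul_mul,
      Matrix.mul_smul, smul_smul, hcc, e1, hS3, e2]
    module
  have hππ : πp * πp = πp := by
    rw [hπ_def, Matrix.smul_mul, Matrix.mul_smul, hY, smul_smul, smul_smul, mul_assoc, inv_mul_cancel₀ h2v,
      mul_one]
  -- the group average Q
  have hGpos : 0 < Fintype.card G := Fintype.card_pos
  have hG0 : (Fintype.card G : ℂ) ≠ 0 := by exact_mod_cast hGpos.ne'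
  set Q : Matrix V V ℂ := (Fintype.card G : ℂ)⁻¹ • ∑ g : G, Pm g with hQ_def
  have hsumP : ∀ g : G, (∑ h : G, Pm h) * Pm g = ∑ h : G, Pm h := by
    intro g
    rw [Finset.sum_mul]
    simp_rw [hPP]
    exact Fintype.sum_equiv (Equiv.mulLeft g) _ _ (fun h => rfl)
  have hQQ : Q * Q = Q := by
    rw [hQ_def, Matrix.smul_mul, Matrix.mul_smul, Matrix.mul_sum, smul_smul]
    simp_rw [hsumP]
    rw [Finset.sum_const, Finset.card_univ, ← Nat.cast_smul_eq_nsmul ℂ, smul_smul, mul_assoc,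
      inv_mul_cancel₀ hG0, mul_one]
  have hQπ : Commute Q πp := by
    rw [hQ_def, hπ_def]
    refine Commute.smul_left (Commute.smul_right ?_ _) _
    refine Commute.sum_left _ _ _ fun g _ => ?_
    have hg : Commute (Pm g) Sc := hPS g
    exact (hg.mul_right hg).add_right (hg.smul_right c)
  set E : Matrix V V ℂ := Q * πp with hE_def
  have hEE : E * E = E := by
    calc Q * πp * (Q * πp) = Q * (πp * Q) * πp := by simp only [Matrix.mul_assoc]
      _ = Q * (Q * πp) * πp := by rw [hQπ.eq]
      _ = (Q * Q) * (πp * πp) := by simp only [Matrix.mul_assoc]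
      _ = Q * πp := by rw [hQQ, hππ]
  obtain ⟨r, hr⟩ := trace_natCast_of_idempotent E hEE
  -- trace of E
  have htrE : E.trace = (2 * (Fintype.card G : ℂ))⁻¹ *
      ∑ g : G, (((univ.filter fun x => (g : Equiv.Perm V) x = x).card : ℂ) - 1) := by
    have hE' : E = ((Fintype.card G : ℂ)⁻¹ * (2 * (333 : ℂ))⁻¹) •
        ∑ g : G, (Pm g * (Sc * Sc) + c • (Pm g * Sc)) := by
      rw [hE_def, hQ_def, hπ_def, Matrix.smul_mul, Matrix.mul_smul, smul_smul, Finset.sum_mul]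
      congr 1
      refine Finset.sum_congr rfl fun g _ => ?_
      rw [Matrix.mul_add, Matrix.mul_smul]
    rw [hE', Matrix.trace_smul, Matrix.trace_sum]
    simp only [Matrix.trace_add, Matrix.trace_smul, htrPS2, htrPS, smul_eq_mul, mul_zero, add_zero]
    rw [Finset.mul_sum, Finset.mul_sum]
    refine Finset.sum_congr rfl fun g _ => ?_
    field_simp
  -- Burnside
  have hfixcard : ∀ g : G, Fintype.card (fixedBy V g) = (univ.filter fun x => (g : Equiv.Perm V) x = x).card := by
    intro g
    rw [← Set.toFinset_card]
    congr 1
    ext y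
    rw [Set.mem_toFinset, Finset.mem_filter, MulAction.mem_fixedBy]
    simp [Subgroup.smul_def, Equiv.Perm.smul_def]
  have hB := MulAction.sum_card_fixedBy_eq_card_orbits_mul_card_group G V
  set N := Fintype.card (Quotient (orbitRel G V)) with hNdef
  have hsumfix : ∑ g : G, (((univ.filter fun x => (g : Equiv.Perm V) x = x).card : ℂ)) = (N * Fintype.card G : ℕ) := by
    rw [← hB]
    push_cast
    refine Finset.sum_congr rfl fun g _ => ?_
    rw [hfixcard]
  rw [Finset.sum_sub_distrib, hsumfix, Finset.sum_const, Finset.card_univ, nsmul_eq_mul, mul_one] at htrE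
  rw [htrE] at hr
  have h2c : (2 * (Fintype.card G : ℂ)) ≠ 0 := mul_ne_zero two_ne_zero hG0
  rw [inv_mul_eq_iff_eq_mul₀ h2c] at hr
  push_cast at hr
  have h3 : N * Fintype.card G = Fintype.card G + 2 * Fintype.card G * r := by
    have : ((N * Fintype.card G : ℕ) : ℂ) = ((Fintype.card G + 2 * Fintype.card G * r : ℕ) : ℂ) := by
      push_cast; linear_combination hr
    exact_mod_cast this
  have h4 : N = 1 + 2 * r := by
    have : Fintype.card G * N = Fintype.card G * (1 + 2 * r) := by linarith [h3]
    exact Nat.eq_of_mul_eq_mul_left hGpos this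
  have hNat : Nat.card (orbitRel.Quotient G V) = N :=
    (Nat.card_eq_fintype_card).trans (Fintype.card_congr' rfl)
  rw [hNat, h4]
  exact ⟨r, by ring⟩

/-- **At least three orbits** when `37 ∤ |G|`: one orbit (transitivity) would force `333 ∣ |G|`. -/
theorem autGroup_three_le_card_orbits (hV : Fintype.card V = 333) (A : Matrix V V ℤ)
    (h01 : ∀ x y, A x y = 0 ∨ A x y = 1) (hsymm : ∀ x y, A y x = A x y) (hdiag : ∀ x, A x x = 0)
    (hk : ∀ x, ∑ y, A x y = 166) (hsrg : ∀ x y, ∑ z, A x z * A z y = 83 * (1 + (if x = y then 1 else 0)) - A x y)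
    (G : Subgroup (Equiv.Perm V)) (hG : ∀ g ∈ G, ∀ x y, A (g x) (g y) = A x y) (h37 : ¬ 37 ∣ Nat.card G) :
    3 ≤ Nat.card (orbitRel.Quotient G V) := by
  classical
  obtain ⟨r, hr⟩ := autGroup_card_orbits_odd hV A h01 hsymm hdiag hk hsrg G hG h37
  -- not 1: a single orbit has size 333 = |G| / |stabiliser|, so 37 ∣ |G|
  by_contra hlt
  have h1 : Nat.card (orbitRel.Quotient G V) = 1 := by omega
  haveI : Nonempty V := Fintype.card_pos_iff.mp (by rw [hV]; norm_num)
  obtain ⟨x⟩ := ‹Nonempty V›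
  -- transitivity: the orbit of x is everything
  have hsub : Subsingleton (orbitRel.Quotient G V) := (Nat.card_eq_one_iff_unique.mp h1).1
  have horb : ∀ y : V, y ∈ orbit G x := by
    intro y
    have : (Quotient.mk (orbitRel G V) y : orbitRel.Quotient G V) = Quotient.mk _ x := Subsingleton.elim _ _
    exact Quotient.exact this
  have hcard : (orbit G x).ncard = 333 := by
    rw [show orbit G x = Set.univ from Set.eq_univ_iff_forall.mpr horb, Set.ncard_univ, Nat.card_eq_fintype_card, hV]
  have hidx : (stabilizer G x).index = 333 := by rw [MulAction.index_stabilizer, hcard]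
  have hdvd : 333 ∣ Nat.card G := hidx ▸ (stabilizer G x).index_dvd_card
  exact h37 (dvd_trans (by norm_num : 37 ∣ 333) hdvd)

end grouporbits

end Summit.Ventures.DiscreteObjects.Hadamard
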